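import Summits.ValiantsHypothesis.ValiantsHypothesis.Theses.PrincipalMinorColouring
import Literature.Computability.AlgebraicComplexity.ReadKDeterminantalRepresentationsProofs

/-!
# Route PrincipalMinorColouring — the crux `TotalRankSuperlinear` (stmt-ValiantsHypothesis-3776) is PROVED:
# Hrubeš–Joglekar 2025, Thm. 7 + the block-determinant dictionary

Crux (rank 2) of route `PrincipalMinorColouring`: «there are `ε > 0` and `n₀` such that for
`n ≥ n₀` every principal-minor representation `per_n(x+J) = n!·det(I_R + diag(x∘κ) K)` has
`R ≥ n^(2+ε)`». Grounders (g13-3, g13-12, 2026-08-15) located it IN PRINT modulo an elementary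
dictionary: Hrubeš–Joglekar, *On read-k projections of the determinant*, STACS 2025 (LIPIcs 327:53),
Thm. 7 — every SYMBOLIC determinantal representation of `per_n` (entries variables or constants) has
variable size `≥ c·n^{5/2}/log n` in characteristic `≠ 2` — is the tree THEOREM
`Literature.Computability.AlgebraicComplexity.HrubesJoglekar2025_variableSize_perPoly_holds`
(`ReadKDeterminantalRepresentationsProofs.lean`). This file supplies the dictionary and closes the crux:

* `exists_symbDetRepr_of_eq_det` — **the dictionary**: if `f = C s · det(D₀ + diag(X∘κ)·B)` for
  constant `R × R` matrices `D₀, B`, then `f` has a symbolic determinantal representation (in the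
  sense of `IsSymbDetRepr`) of variable size EXACTLY `R`: the block matrix
  `[[s]] ⊕ [[1, -B], [diag(X∘κ), D₀]]` (size `1 + 2R`), whose only variable entries are the `R`
  diagonal entries `X (κ i)`; `det = s · det(D₀ - diag(X∘κ)(-B))` (`Matrix.det_fromBlocks_one₁₁`).
* `rpow_le_of_symbDetRepr` — Thm. 7 turned into the route's shape: there are `ε > 0` (`ε = 1/4`) and
  `n₁` with `n^(2+ε) ≤ R` whenever `per_n` has a symbolic representation of variable size `R`,
  `n ≥ n₁` (`log n ≤ c·n^{1/4}` eventually, `isLittleO_log_rpow_atTop`).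
* `totalRankSuperlinear_proof` — undo the shift `x ↦ x + J` by the algebra automorphism
  `X e ↦ X e - 1`: `per_n = C(n!) · det((1 - K) + diag(X∘κ) K)`, then the two lemmas.
The same dictionary closes route ContractivityPrice's crux `CdcSuperquadratic` (re-centred at
`I + X/(4n)`; file `ContractivityPriceCdcSuperquadratic.lean`). Honest framing: a published lower
bound (`n^{2+1/4}`, far below the route's target `PMCNotQP`) formalised; nothing here is progress on
`VP ≠ VNP`. References: Hrubeš–Joglekar 2025, Thm. 7 [HrubesJoglekar2025].
-/

set_option linter.dupNamespace false

namespace Summit.ValiantsHypothesis.ValiantsHypothesis.Theorems.PrincipalMinorColouring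

open MvPolynomial Matrix Filter Literature.Computability.AlgebraicComplexity
open Summit.ValiantsHypothesis.ValiantsHypothesis.Theses.PrincipalMinorColouring

/-! ### The dictionary: `C s · det(D₀ + diag(X∘κ)·B)` has a symbolic representation of variable size `R` -/

/-- **Block-determinant dictionary.** If `f = C s · det(D₀ + diag(X ∘ κ) · B)` with constant
`R × R` matrices `D₀, B`, then `f` has a symbolic determinantal representation (entries variables or
constants) of variable size exactly `R`: the block matrix `[[s]] ⊕ [[1, -B], [diag(X∘κ), D₀]]`.
[folklore] -/
theorem exists_symbDetRepr_of_eq_det {n R : ℕ} (s : ℂ) (D₀ B : Matrix (Fin R) (Fin R) ℂ)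
    (κ : Fin R → Fin n × Fin n) {f : MvPolynomial (Fin n × Fin n) ℂ}
    (hf : f = C s * (D₀.map C + Matrix.diagonal (fun i => X (κ i)) * B.map C).det) :
    ∃ (m : ℕ) (M : Matrix (Fin m) (Fin m) ((Fin n × Fin n) ⊕ ℂ)),
      IsSymbDetRepr f M ∧ variableSize M = R := by
  classical
  -- the symbolic blocks
  let Cb : Matrix (Fin R) (Fin R) ((Fin n × Fin n) ⊕ ℂ) :=
    fun i j => if i = j then Sum.inl (κ i) else Sum.inr 0
  let inner : Matrix (Fin R ⊕ Fin R) (Fin R ⊕ Fin R) ((Fin n × Fin n) ⊕ ℂ) :=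
    Matrix.fromBlocks ((1 : Matrix (Fin R) (Fin R) ℂ).map Sum.inr) ((-B).map Sum.inr) Cb
      (D₀.map Sum.inr)
  let outer : Matrix (Fin 1 ⊕ (Fin R ⊕ Fin R)) (Fin 1 ⊕ (Fin R ⊕ Fin R)) ((Fin n × Fin n) ⊕ ℂ) :=
    Matrix.fromBlocks (fun _ _ => Sum.inr s) (fun _ _ => Sum.inr 0) (fun _ _ => Sum.inr 0) inner
  let e : Fin 1 ⊕ (Fin R ⊕ Fin R) ≃ Fin (1 + (R + R)) :=
    (Equiv.sumCongr (Equiv.refl (Fin 1)) finSumFinEquiv).trans finSumFinEquiv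
  refine ⟨1 + (R + R), Matrix.reindex e e outer, ?_, ?_⟩
  · -- determinant
    have hCb : Cb.map (Sum.elim X C) = Matrix.diagonal (fun i => (X (κ i) : MvPolynomial (Fin n × Fin n) ℂ)) := by
      ext i j
      by_cases hij : i = j
      · subst hij
        simp [Cb, Matrix.diagonal]
      · simp [Cb, Matrix.diagonal, hij]
    have hinner : inner.map (Sum.elim X C) =
        Matrix.fromBlocks 1 (-(B.map C)) (Matrix.diagonal fun i => X (κ i)) (D₀.map C) := by
      simp only [inner, Matrix.fromBlocks_map, Matrix.map_map, hCb]
      have h1 : ((1 : Matrix (Fin R) (Fin R) ℂ).map (Sum.elim X C ∘ Sum.inr) :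
          Matrix (Fin R) (Fin R) (MvPolynomial (Fin n × Fin n) ℂ)) = 1 := by
        rw [show (Sum.elim X C ∘ Sum.inr : ℂ → MvPolynomial (Fin n × Fin n) ℂ) = C from rfl]
        exact Matrix.map_one C (map_zero C) (map_one C)
      have h2 : ((-B).map (Sum.elim X C ∘ Sum.inr) : Matrix (Fin R) (Fin R) (MvPolynomial (Fin n × Fin n) ℂ)) =
          -(B.map C) := by
        rw [show (Sum.elim X C ∘ Sum.inr : ℂ → MvPolynomial (Fin n × Fin n) ℂ) = C from rfl]
        exact Matrix.map_neg C (map_neg C) B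
      have h3 : (D₀.map (Sum.elim X C ∘ Sum.inr) : Matrix (Fin R) (Fin R) (MvPolynomial (Fin n × Fin n) ℂ)) =
          D₀.map C := rfl
      rw [h1, h2, h3]
    have houter : outer.map (Sum.elim X C) =
        Matrix.fromBlocks (fun _ _ => C s) 0 0 (inner.map (Sum.elim X C)) := by
      simp only [outer, Matrix.fromBlocks_map]
      congr 1 <;> ext <;> simp
    unfold IsSymbDetRepr symbPoly
    rw [Matrix.reindex_apply, ← Matrix.submatrix_map, Matrix.det_submatrix_equiv_self, houter,
      Matrix.det_fromBlocks_zero₂₁, Matrix.det_unique, hinner, Matrix.det_fromBlocks_one₁₁, hf,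
      Matrix.mul_neg, sub_neg_eq_add]
  · -- variable size: exactly the `R` diagonal entries of the lower-left block
    let g : Fin R → {ij : Fin (1 + (R + R)) × Fin (1 + (R + R)) //
        ∃ v : Fin n × Fin n, Matrix.reindex e e outer ij.1 ij.2 = Sum.inl v} :=
      fun i => ⟨(e (Sum.inr (Sum.inr i)), e (Sum.inr (Sum.inl i))), ⟨κ i, by
        simp [outer, inner, Cb, Matrix.reindex_apply, Matrix.submatrix_apply]⟩⟩
    have hg : Function.Bijective g := by
      constructor
      · intro i j hij
        have h := congrArg (fun x => e.symm x.1.2) hij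
        simpa [g] using h
      · rintro ⟨⟨p, q⟩, v, hv⟩
        -- pull back along `e`
        obtain ⟨p', rfl⟩ := e.surjective p
        obtain ⟨q', rfl⟩ := e.surjective q
        simp only [Matrix.reindex_apply, Matrix.submatrix_apply, Equiv.symm_apply_apply] at hv
        rcases p' with p₀ | (p₁ | p₂) <;> rcases q' with q₀ | (q₁ | q₂)
        · simp only [outer, Matrix.fromBlocks_apply₁₁] at hv
          exact absurd hv (by simp)
        · simp only [outer, Matrix.fromBlocks_apply₁₂] at hv
          exact absurd hv (by simp)
        · simp only [outer, Matrix.fromBlocks_apply₁₂] at hv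
          exact absurd hv (by simp)
        · simp only [outer, Matrix.fromBlocks_apply₂₁] at hv
          exact absurd hv (by simp)
        · simp only [outer, inner, Matrix.fromBlocks_apply₂₂, Matrix.fromBlocks_apply₁₁,
            Matrix.map_apply] at hv
          exact absurd hv (by simp)
        · simp only [outer, inner, Matrix.fromBlocks_apply₂₂, Matrix.fromBlocks_apply₁₂,
            Matrix.map_apply] at hv
          exact absurd hv (by simp)
        · simp only [outer, Matrix.fromBlocks_apply₂₁] at hv
          exact absurd hv (by simp)
        · -- the lower-left block: `Cb p₂ q₁ = inl v` forces `p₂ = q₁`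
          have hpq : p₂ = q₁ := by
            by_contra hne
            simp only [outer, inner, Matrix.fromBlocks_apply₂₂, Matrix.fromBlocks_apply₂₁, Cb,
              if_neg hne] at hv
            exact absurd hv (by simp)
          subst hpq
          exact ⟨p₂, Subtype.ext rfl⟩
        · simp only [outer, inner, Matrix.fromBlocks_apply₂₂, Matrix.map_apply] at hv
          exact absurd hv (by simp)
    exact Nat.card_eq_of_equiv_fin (Equiv.ofBijective g hg).symm

/-! ### Hrubeš–Joglekar's variable-size bound in the route's `n^(2+ε)` shape -/

/-- **Thm. 7 of Hrubeš–Joglekar 2025 in `n^(2+ε)` form** (`ε = 1/4`): for all large `n`, if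
`per_n` has a symbolic determinantal representation of variable size `R` then `n^(2+1/4) ≤ R`
(`c·n^{5/2}/log n ≤ R` and `log n ≤ c·n^{1/4}` eventually). [cite: HrubesJoglekar2025, Thm. 7] -/
theorem rpow_le_of_symbDetRepr :
    ∃ ε : ℝ, 0 < ε ∧ ∃ n₁ : ℕ, ∀ n ≥ n₁, ∀ R : ℕ,
      (∃ (m : ℕ) (M : Matrix (Fin m) (Fin m) ((Fin n × Fin n) ⊕ ℂ)),
        IsSymbDetRepr (perPoly (Fin n) ℂ) M ∧ variableSize M = R) →
      (n : ℝ) ^ (2 + ε) ≤ R := by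
  obtain ⟨c, hc, n₀, H⟩ := HrubesJoglekar2025_variableSize_perPoly_holds ℂ
    (by rw [ringChar.eq_zero]; norm_num)
  have hlo := isLittleO_log_rpow_atTop (show (0 : ℝ) < 1 / 4 by norm_num)
  have hev : ∀ᶠ x : ℝ in atTop, ‖Real.log x‖ ≤ c * ‖x ^ (1 / 4 : ℝ)‖ := hlo.def hc
  obtain ⟨n₂, hn₂⟩ := Filter.eventually_atTop.1 (tendsto_natCast_atTop_atTop.eventually hev)
  refine ⟨1 / 4, by norm_num, max (max n₀ n₂) 2, fun n hn R ⟨m, M, hM, hR⟩ => ?_⟩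
  have hn₀ : n₀ ≤ n := le_trans (le_trans (le_max_left _ _) (le_max_left _ _)) hn
  have hn2 : 2 ≤ n := le_trans (le_max_right _ _) hn
  have hnn₂ : n₂ ≤ n := le_trans (le_trans (le_max_right _ _) (le_max_left _ _)) hn
  have h1 : c * (n : ℝ) ^ ((5 : ℝ) / 2) / Real.log n ≤ (R : ℝ) := by
    have := H n hn₀ m M hM
    rwa [hR] at this
  have hnpos : (0 : ℝ) < n := by exact_mod_cast (lt_of_lt_of_le (by norm_num) hn2)
  have hlog : 0 < Real.log n := Real.log_pos (by exact_mod_cast (lt_of_lt_of_le (by norm_num) hn2))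
  have h2 : Real.log n ≤ c * (n : ℝ) ^ (1 / 4 : ℝ) := by
    have h := hn₂ n hnn₂
    rw [Real.norm_of_nonneg hlog.le, Real.norm_of_nonneg (Real.rpow_nonneg hnpos.le _)] at h
    exact h
  have hquarter : 0 < c * (n : ℝ) ^ (1 / 4 : ℝ) := mul_pos hc (Real.rpow_pos_of_pos hnpos _)
  calc (n : ℝ) ^ (2 + 1 / 4 : ℝ)
      = c * (n : ℝ) ^ ((5 : ℝ) / 2) / (c * (n : ℝ) ^ (1 / 4 : ℝ)) := by
        rw [mul_div_mul_left _ _ hc.ne', ← Real.rpow_sub hnpos]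
        norm_num
    _ ≤ c * (n : ℝ) ^ ((5 : ℝ) / 2) / Real.log n :=
        div_le_div_of_nonneg_left (mul_pos hc (Real.rpow_pos_of_pos hnpos _)).le hlog h2
    _ ≤ R := h1

/-! ### The crux -/

/-- **Crux `TotalRankSuperlinear` (stmt-ValiantsHypothesis-3776), PROVED** with `ε = 1/4`: undo the
shift `x ↦ x + J` (algebra automorphism `X e ↦ X e - 1`) to get
`per_n = C(n!) · det((1 - K) + diag(X∘κ)·K)`, read it as a symbolic representation of variable size
`R` (dictionary), and apply Hrubeš–Joglekar's Thm. 7. [cite: HrubesJoglekar2025, Thm. 7] -/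
theorem totalRankSuperlinear_proof : TotalRankSuperlinear := by
  obtain ⟨ε, hε, n₁, hmain⟩ := rpow_le_of_symbDetRepr
  refine ⟨ε, hε, n₁, fun n hn R K κ h => hmain n hn R ?_⟩
  -- undo the shift
  set ψ : MvPolynomial (Fin n × Fin n) ℂ →ₐ[ℂ] MvPolynomial (Fin n × Fin n) ℂ :=
    aeval (fun e => X e - 1) with hψ
  have hcomp : ∀ p : MvPolynomial (Fin n × Fin n) ℂ, ψ (aeval (fun e => X e + 1) p) = p := by
    intro p
    have h1 : ψ.comp (aeval fun e : Fin n × Fin n => (X e + 1 : MvPolynomial (Fin n × Fin n) ℂ)) =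
        AlgHom.id ℂ _ := by
      rw [comp_aeval]
      have : (fun i : Fin n × Fin n => ψ (X i + 1)) = X := by
        funext i
        simp [hψ]
      rw [this, aeval_X_left]
    exact congrArg (fun F : MvPolynomial (Fin n × Fin n) ℂ →ₐ[ℂ] MvPolynomial (Fin n × Fin n) ℂ => F p) h1
  have hK : (K.map C : Matrix (Fin R) (Fin R) (MvPolynomial (Fin n × Fin n) ℂ)).map ψ = K.map C := by
    rw [Matrix.map_map]
    congr 1
    funext a
    exact ψ.commutes a
  have hD : (Matrix.diagonal (fun i => (X (κ i) : MvPolynomial (Fin n × Fin n) ℂ))).map ψ =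
      Matrix.diagonal (fun i => X (κ i)) - 1 := by
    rw [Matrix.diagonal_map (map_zero ψ), ← Matrix.diagonal_one, Matrix.diagonal_sub]
    congr 1
    funext i
    simp [hψ]
  have hmat : ψ.mapMatrix (1 + Matrix.diagonal (fun i => (X (κ i) : MvPolynomial (Fin n × Fin n) ℂ)) *
      K.map C) = 1 + (Matrix.diagonal (fun i => X (κ i)) - 1) * K.map C := by
    rw [map_add, map_one, map_mul, AlgHom.mapMatrix_apply, AlgHom.mapMatrix_apply, hK, hD]
  have key := congrArg ψ h
  rw [hcomp, map_mul, AlgHom.map_det, hmat] at key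
  have hψC : ψ (C (n.factorial : ℂ)) = C (n.factorial : ℂ) := ψ.commutes _
  rw [hψC] at key
  refine exists_symbDetRepr_of_eq_det (n.factorial : ℂ) (1 - K) K κ (key.trans ?_)
  congr 2
  rw [Matrix.map_sub C (map_sub C), Matrix.map_one C (map_zero C) (map_one C), sub_mul, one_mul]
  abel

end Summit.ValiantsHypothesis.ValiantsHypothesis.Theorems.PrincipalMinorColouring
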